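import Summits.ABC.ABC.Theorems.IneffectiveSubspaceUniformSadicTowerFourHeavyGivesBoundedOmega
import Literature.NumberTheory.DiophantineGeometry.AbcWave0SUnitProofs

/-!
# `UniformSadicTowerFour` (stmt-ABC-14937) modulo crux #6: the COLLAPSE of the rungs (line `flat-steep-split`, lead c2)

Crux #2 of route `IneffectiveSubspace` ("Ridout at level four") and its heavy child sit in a chain of
necessary rungs, all consequences of `ABC` and all landed as implications:

  `ABC ⟹ UniformSadicTowerFour ⟹ HEAVY-CORE ⟹ BoundedOmegaABC`  and
  `UniformSadicTowerFour ⟹ (level-one rung at every budget K) ⟹ BoundedOmegaABC`,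

where BoundedOmegaABC is abc on every bounded-`ω` cell `{ω(abc) ≤ W}` with `C(W, ε)` — equivalently the
UNIFORM `S`-unit theorem "for every set `S` of at most `W` primes every coprime `S`-unit solution of
`a + b = c` has `c < C(W,ε)·(∏_{p∈S} p)^(1+ε)`" — and the level-one rung is uniform Mahler–Ridout with linear
`S`-loss (`MixedRadical.stub_levelOneRung_of_mixed`).  This file records:

* `levelOne_bracket_self`, `boundedOmega_of_levelOneRung`: the level-one rung at budget `W`, read at
  `S := supp(abc)`, IS abc on the cell `{ω(abc) ≤ W}`;
* `boundedOmega_of_uniformSadicTowerFour`: the crux gives BoundedOmegaABC (unconditionally);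
* `tfae_of_deepRegimeABC` (**the collapse**): under the route's other load-bearing crux #6 `DeepRegimeABC`
  (stmt-ABC-15121) the five statements `ABC`, `UniformSadicTowerFour`, HEAVY-CORE, level-one rung (all `K`),
  BoundedOmegaABC are pairwise EQUIVALENT (the closing arrow is the landed complement theorem
  `DeepRegimeABC.abc_of_deepRegimeABC_of_boundedOmega`);
* the cell `W = 2` of BoundedOmegaABC is already a theorem of the tree (`MixedRadical.stub_omegaCounted_two`,
  `Theorems/IneffectiveSubspaceUniformSadicTowerFourStubOmegaCountedTwo.lean`, not restated here), so the first open
  cell of crux #2 modulo #6 is `W = 3`: the three-prime triples `1 + p^x q^y = r^z`, `1 + p^x = q^y r^z`,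
  `p^x + q^y = r^z` (census `Cruxes/UniformSadicTowerFour/Census-omega3-c2.md`: 18 hits with quality > 1, all with
  `c ≤ 2^17`, none up to `10^11`);
* `abc_fixedSupport`, `mixed_fixedSupport` (**per support everything is a theorem**): for every FIXED finite
  `S₀ ⊆ ℕ`, abc — and hence the crux's mixed inequality for every `S` — holds with a constant `C(S₀)` on the
  triples supported in `S₀`, by the PROVED `S`-unit finiteness theorem of the tree
  (`finite_setOf_isABCTriple_primeFactors_subset_holds`, Mahler 1933 over Bombieri–Gubler Thm 5.2.1);
* `boundedOmega_iff_uniformSUnit`: BoundedOmegaABC ⟺ the UNIFORM `S`-unit theorem with linear `S`-loss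
  (`∀ W ε ∃ C ∀ S, |S| ≤ W → ∀ S-supported abc triples: c < C·(∏_{p∈S} p)^(1+ε)`).  So, modulo #6, crux #2 is
  EXACTLY the uniformity in `S` (at cost `(∏_{p∈S} p)^(1+ε)`, budget `|S| ≤ W`) of an in-tree theorem — "Mahler made
  uniform", at level ONE; the level-four tower contributes nothing the route consumes.

Reading for the planner: for THIS route (which carries #6 as a hypothesis of `closes`) the binder #2 may be
replaced by any rung of the chain — its heavy child `HeavyPlacesFour`, the level-one rung, or BoundedOmegaABC
itself — without changing what `closes` proves; the level-4 / `rad₄` structure of #2 and its flat face are not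
consumed.  No new definitions.  Deliberately NOT here: any of the rungs themselves (open, abc-type).
-/

noncomputable section

-- `Summit.<Summit>.<Problem>` is the mandated summit-side namespace (CONVENTIONS §2); for the
-- single-conjunct summit `ABC` the two coincide, so the duplicate `ABC.ABC` is deliberate.
set_option linter.dupNamespace false

namespace Summit.ABC.ABC.Theorems.UniformSadicTowerFour.HeavyPlaces

open Literature.NumberTheory.DiophantineGeometry
  (IsABCTriple rad rad_def finite_setOf_isABCTriple_primeFactors_subset_holds)
open Summit.ABC.ABC.Theses.IneffectiveSubspace
open Summit.ABC.ABC.Theorems.UniformSadicTowerFour.FlatSteepSplit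
  (heavyCore_of_abc uniformSadicTowerFour_iff_quarter_and_core)
open Summit.ABC.ABC.Theorems.UniformSadicTowerFour.MixedRadical
  (levelOneRung_of_uniformSadicTowerFour uniformInK_rad_le_mixed)
open Summit.ABC.ABC.Theorems.DeepRegimeABC (abc_of_deepRegimeABC_of_boundedOmega deepRegimeABC_of_abc)
open scoped BigOperators

/-! ## The level-one rung at `S = supp(abc)` is abc on bounded-`ω` cells -/

/-- At `S := (abc).primeFactors` the level-one bracket `(∏_{p∈S} p) · {abc}^S` is the radical on the nose:
the `S`-free part is an empty product. [folklore] -/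
theorem levelOne_bracket_self (a b c : ℕ) :
    (∏ p ∈ (a * b * c).primeFactors, p) *
        ∏ p ∈ (a * b * c).primeFactors \ (a * b * c).primeFactors, p ^ (a * b * c).factorization p =
      rad a b c := by
  rw [Finset.sdiff_self, Finset.prod_empty, mul_one, rad_def, Nat.radical_eq_prod_primeFactors]

/-- **Level-one rung (every budget) ⟹ BoundedOmegaABC.** Uniform Mahler–Ridout with linear `S`-loss at
budget `W`, applied at `S := supp(abc)` (admissible exactly when `ω(abc) ≤ W`), is abc on the cell
`{ω(abc) ≤ W}` with the same constant. [folklore] -/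
theorem boundedOmega_of_levelOneRung
    (h : ∀ K : ℕ, ∀ ε : ℝ, 0 < ε → ∃ C : ℝ, 0 < C ∧ ∀ S : Finset ℕ, S.card ≤ K → (∀ p ∈ S, Nat.Prime p) →
      ∀ a b c : ℕ, IsABCTriple a b c →
        (c : ℝ) < C * ((((∏ p ∈ S, p) *
          ∏ p ∈ (a * b * c).primeFactors \ S, p ^ (a * b * c).factorization p : ℕ) : ℝ)) ^ (1 + ε)) :
    ∀ W : ℕ, ∀ ε : ℝ, 0 < ε → ∃ C : ℝ, 0 < C ∧ ∀ a b c : ℕ, IsABCTriple a b c →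
      (a * b * c).primeFactors.card ≤ W →
      (c : ℝ) < C * ((rad a b c : ℕ) : ℝ) ^ (1 + ε) := by
  intro W ε hε
  obtain ⟨C, hC, hW⟩ := h W ε hε
  refine ⟨C, hC, fun a b c habc hcard => ?_⟩
  have key := hW (a * b * c).primeFactors hcard (fun p hp => Nat.prime_of_mem_primeFactors hp)
    a b c habc
  rwa [levelOne_bracket_self] at key

/-- **The crux gives abc on bounded-`ω` cells** (unconditionally; two routes: through its heavy child,
`boundedOmega_of_heavyCore`, or through the level-one rung as here). [folklore] -/
theorem boundedOmega_of_uniformSadicTowerFour (hU : UniformSadicTowerFour) :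
    ∀ W : ℕ, ∀ ε : ℝ, 0 < ε → ∃ C : ℝ, 0 < C ∧ ∀ a b c : ℕ, IsABCTriple a b c →
      (a * b * c).primeFactors.card ≤ W →
      (c : ℝ) < C * ((rad a b c : ℕ) : ℝ) ^ (1 + ε) :=
  boundedOmega_of_levelOneRung (levelOneRung_of_uniformSadicTowerFour hU)

/-- **BoundedOmegaABC ∧ DeepRegimeABC ⟹ level-one rung at every budget** (through `ABC` and the crux).
[folklore] -/
theorem levelOneRung_of_boundedOmega_of_deepRegimeABC
    (hB : ∀ W : ℕ, ∀ ε : ℝ, 0 < ε → ∃ C : ℝ, 0 < C ∧ ∀ a b c : ℕ, IsABCTriple a b c →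
      (a * b * c).primeFactors.card ≤ W →
      (c : ℝ) < C * ((rad a b c : ℕ) : ℝ) ^ (1 + ε))
    (h₆ : DeepRegimeABC) :
    ∀ K : ℕ, ∀ ε : ℝ, 0 < ε → ∃ C : ℝ, 0 < C ∧ ∀ S : Finset ℕ, S.card ≤ K → (∀ p ∈ S, Nat.Prime p) →
      ∀ a b c : ℕ, IsABCTriple a b c →
        (c : ℝ) < C * ((((∏ p ∈ S, p) *
          ∏ p ∈ (a * b * c).primeFactors \ S, p ^ (a * b * c).factorization p : ℕ) : ℝ)) ^ (1 + ε) :=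
  levelOneRung_of_uniformSadicTowerFour
    ((show ABC → UniformSadicTowerFour from abcGivesUniformSadic_proof)
      (abc_of_deepRegimeABC_of_boundedOmega h₆ hB))

/-! ## The collapse modulo crux #6 -/

/-- **Collapse of the rungs modulo `DeepRegimeABC`.** Under crux #6 of the route the following are
pairwise equivalent: `ABC`; the crux `UniformSadicTowerFour`; its heavy child HEAVY-CORE; the level-one rung
(uniform Mahler–Ridout with linear `S`-loss) at every budget; abc on every bounded-`ω` cell (BoundedOmegaABC).
Arrows: `abcGivesUniformSadic_proof`, `uniformSadicTowerFour_iff_quarter_and_core`,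
`boundedOmega_of_heavyCore` (p139963), `levelOneRung_of_uniformSadicTowerFour`, `boundedOmega_of_levelOneRung`,
and the complement theorem `abc_of_deepRegimeABC_of_boundedOmega`. [folklore] -/
theorem tfae_of_deepRegimeABC (h₆ : DeepRegimeABC) :
    List.TFAE [
      ABC,
      UniformSadicTowerFour,
      (∀ θ : ℝ, 0 < θ → θ ≤ 1 → ∀ ε : ℝ, 0 < ε → ∃ C : ℝ, 0 < C ∧ ∀ S : Finset ℕ, S.Nonempty →
        (∀ p ∈ S, Nat.Prime p) → ∀ a b c : ℕ, IsABCTriple a b c →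
        (∀ p ∈ S, (c : ℝ) ^ θ ≤ ((p ^ (a * b * c).factorization p : ℕ) : ℝ)) →
        (c : ℝ) < C * ((((∏ p ∈ S, p) *
          ∏ p ∈ (a * b * c).primeFactors \ S, p ^ (((a * b * c).factorization p + 3) / 4) : ℕ) : ℝ)) ^
            (1 + ε)),
      (∀ K : ℕ, ∀ ε : ℝ, 0 < ε → ∃ C : ℝ, 0 < C ∧ ∀ S : Finset ℕ, S.card ≤ K → (∀ p ∈ S, Nat.Prime p) →
        ∀ a b c : ℕ, IsABCTriple a b c →
          (c : ℝ) < C * ((((∏ p ∈ S, p) *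
            ∏ p ∈ (a * b * c).primeFactors \ S, p ^ (a * b * c).factorization p : ℕ) : ℝ)) ^ (1 + ε)),
      (∀ W : ℕ, ∀ ε : ℝ, 0 < ε → ∃ C : ℝ, 0 < C ∧ ∀ a b c : ℕ, IsABCTriple a b c →
        (a * b * c).primeFactors.card ≤ W →
        (c : ℝ) < C * ((rad a b c : ℕ) : ℝ) ^ (1 + ε))] := by
  tfae_have 1 → 2 := fun h => (show ABC → UniformSadicTowerFour from abcGivesUniformSadic_proof) h
  tfae_have 2 → 3 := fun h => (uniformSadicTowerFour_iff_quarter_and_core.mp h).2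
  tfae_have 3 → 5 := fun h => boundedOmega_of_heavyCore h
  tfae_have 2 → 4 := fun h => levelOneRung_of_uniformSadicTowerFour h
  tfae_have 4 → 5 := fun h => boundedOmega_of_levelOneRung h
  tfae_have 5 → 1 := fun h => abc_of_deepRegimeABC_of_boundedOmega h₆ h
  tfae_finish

/-- **Modulo #6 the crux is abc on bounded-`ω` cells** (the handle most useful to the planner:
`UniformSadicTowerFour ↔ BoundedOmegaABC` under `DeepRegimeABC`). [folklore] -/
theorem uniformSadicTowerFour_iff_boundedOmega_of_deepRegimeABC (h₆ : DeepRegimeABC) :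
    UniformSadicTowerFour ↔
      (∀ W : ℕ, ∀ ε : ℝ, 0 < ε → ∃ C : ℝ, 0 < C ∧ ∀ a b c : ℕ, IsABCTriple a b c →
        (a * b * c).primeFactors.card ≤ W →
        (c : ℝ) < C * ((rad a b c : ℕ) : ℝ) ^ (1 + ε)) :=
  ⟨boundedOmega_of_uniformSadicTowerFour,
    fun hB => (show ABC → UniformSadicTowerFour from abcGivesUniformSadic_proof)
      (abc_of_deepRegimeABC_of_boundedOmega h₆ hB)⟩

/-! ## Per support everything is a theorem; the crux modulo #6 is pure uniformity in `S` -/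

/-- **abc per fixed support** (from the PROVED `S`-unit finiteness theorem): for every finite `S₀ ⊆ ℕ` and
every `ε` there is `C = C(S₀)` with `c < C·rad(abc)^(1+ε)` for every abc triple supported in `S₀` — there are
only finitely many such triples (`finite_setOf_isABCTriple_primeFactors_subset_holds`, Mahler 1933), so
`C := 1 + max c` serves. [folklore] -/
theorem abc_fixedSupport (S₀ : Finset ℕ) :
    ∀ ε : ℝ, 0 < ε → ∃ C : ℝ, 0 < C ∧ ∀ a b c : ℕ, IsABCTriple a b c →
      (a * b * c).primeFactors ⊆ S₀ → (c : ℝ) < C * ((rad a b c : ℕ) : ℝ) ^ (1 + ε) := by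
  classical
  intro ε hε
  have hfin := finite_setOf_isABCTriple_primeFactors_subset_holds S₀
  set T := hfin.toFinset with hT
  set B : ℕ := T.sup (fun t => t.2.2) with hB
  refine ⟨(B : ℝ) + 1, by positivity, fun a b c habc hsub => ?_⟩
  have hmem : (a, b, c) ∈ T := hfin.mem_toFinset.mpr (by exact ⟨habc, hsub⟩)
  have hcB : c ≤ B := Finset.le_sup (f := fun t : ℕ × ℕ × ℕ => t.2.2) hmem
  have hradpos : 0 < rad a b c := by
    rw [rad_def]; exact Nat.pos_of_ne_zero UniqueFactorizationMonoid.radical_ne_zero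
  have hrad : (1 : ℝ) ≤ ((rad a b c : ℕ) : ℝ) := by exact_mod_cast hradpos
  have h1 : (1 : ℝ) ≤ ((rad a b c : ℕ) : ℝ) ^ (1 + ε) := Real.one_le_rpow hrad (by linarith)
  calc (c : ℝ) ≤ B := by exact_mod_cast hcB
    _ < (B : ℝ) + 1 := by linarith
    _ ≤ ((B : ℝ) + 1) * ((rad a b c : ℕ) : ℝ) ^ (1 + ε) := le_mul_of_one_le_right (by positivity) h1

/-- **The crux's inequality per fixed support**: for every finite `S₀ ⊆ ℕ` and `ε > 0` there is `C(S₀, ε)`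
with `c < C·M_S(abc)^(1+ε)` for EVERY finite set of primes `S` (any budget) and every abc triple supported in
`S₀` (`abc_fixedSupport` and `rad ≤ M_S`).  The crux asks for `C` depending on `|S|` only. [folklore] -/
theorem mixed_fixedSupport (S₀ : Finset ℕ) :
    ∀ ε : ℝ, 0 < ε → ∃ C : ℝ, 0 < C ∧ ∀ S : Finset ℕ, (∀ p ∈ S, Nat.Prime p) →
      ∀ a b c : ℕ, IsABCTriple a b c → (a * b * c).primeFactors ⊆ S₀ →
        (c : ℝ) < C * ((((∏ p ∈ S, p) *
          ∏ p ∈ (a * b * c).primeFactors \ S, p ^ (((a * b * c).factorization p + 3) / 4) : ℕ) : ℝ)) ^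
            (1 + ε) := by
  intro ε hε
  obtain ⟨C, hC, hC'⟩ := abc_fixedSupport S₀ ε hε
  refine ⟨C, hC, fun S hS a b c habc hsub => ?_⟩
  have hrad : ((rad a b c : ℕ) : ℝ) ≤
      (((∏ p ∈ S, p) *
        ∏ p ∈ (a * b * c).primeFactors \ S, p ^ (((a * b * c).factorization p + 3) / 4) : ℕ) : ℝ) := by
    exact_mod_cast uniformInK_rad_le_mixed a b c S hS
  calc (c : ℝ) < C * ((rad a b c : ℕ) : ℝ) ^ (1 + ε) := hC' a b c habc hsub
    _ ≤ C * ((((∏ p ∈ S, p) *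
        ∏ p ∈ (a * b * c).primeFactors \ S, p ^ (((a * b * c).factorization p + 3) / 4) : ℕ) : ℝ)) ^
          (1 + ε) := by
      gcongr

/-- **BoundedOmegaABC ⟺ the uniform `S`-unit theorem with linear `S`-loss**: abc on every bounded-`ω` cell is
the same as "for every `W`, `ε` there is `C` such that for every set `S` of at most `W` primes every abc triple
supported in `S` has `c < C·(∏_{p∈S} p)^(1+ε)`" (`→`: `rad(abc) ≤ ∏_{p∈S} p` when `supp(abc) ⊆ S`; `←`: take
`S := supp(abc)`, where `∏ p = rad`).  Per `S` this is `abc_fixedSupport`; the open content is the dependence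
of `C` on `|S|` alone. [folklore] -/
theorem boundedOmega_iff_uniformSUnit :
    (∀ W : ℕ, ∀ ε : ℝ, 0 < ε → ∃ C : ℝ, 0 < C ∧ ∀ a b c : ℕ, IsABCTriple a b c →
      (a * b * c).primeFactors.card ≤ W →
      (c : ℝ) < C * ((rad a b c : ℕ) : ℝ) ^ (1 + ε)) ↔
    (∀ W : ℕ, ∀ ε : ℝ, 0 < ε → ∃ C : ℝ, 0 < C ∧ ∀ S : Finset ℕ, S.card ≤ W → (∀ p ∈ S, Nat.Prime p) →
      ∀ a b c : ℕ, IsABCTriple a b c → (a * b * c).primeFactors ⊆ S →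
        (c : ℝ) < C * ((∏ p ∈ S, p : ℕ) : ℝ) ^ (1 + ε)) := by
  constructor
  · intro h W ε hε
    obtain ⟨C, hC, hC'⟩ := h W ε hε
    refine ⟨C, hC, fun S hcard hS a b c habc hsub => ?_⟩
    have hω : (a * b * c).primeFactors.card ≤ W := (Finset.card_le_card hsub).trans hcard
    have hrad : ((rad a b c : ℕ) : ℝ) ≤ ((∏ p ∈ S, p : ℕ) : ℝ) := by
      have h1 : rad a b c ≤ ∏ p ∈ S, p := by
        rw [rad_def, Nat.radical_eq_prod_primeFactors]
        exact Finset.prod_le_prod_of_subset_of_one_le' hsub fun p hp _ => (hS p hp).one_lt.le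
      exact_mod_cast h1
    calc (c : ℝ) < C * ((rad a b c : ℕ) : ℝ) ^ (1 + ε) := hC' a b c habc hω
      _ ≤ C * ((∏ p ∈ S, p : ℕ) : ℝ) ^ (1 + ε) := by gcongr
  · intro h W ε hε
    obtain ⟨C, hC, hC'⟩ := h W ε hε
    refine ⟨C, hC, fun a b c habc hcard => ?_⟩
    have key := hC' (a * b * c).primeFactors hcard (fun p hp => Nat.prime_of_mem_primeFactors hp)
      a b c habc subset_rfl
    rwa [← Nat.radical_eq_prod_primeFactors, ← rad_def] at key

/-- **Modulo #6 the crux is "Mahler made uniform"**: under `DeepRegimeABC`, `UniformSadicTowerFour` is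
equivalent to the uniform `S`-unit theorem with linear `S`-loss, each instance `S` of which is the theorem
`abc_fixedSupport S`. [folklore] -/
theorem uniformSadicTowerFour_iff_uniformSUnit_of_deepRegimeABC (h₆ : DeepRegimeABC) :
    UniformSadicTowerFour ↔
      (∀ W : ℕ, ∀ ε : ℝ, 0 < ε → ∃ C : ℝ, 0 < C ∧ ∀ S : Finset ℕ, S.card ≤ W → (∀ p ∈ S, Nat.Prime p) →
        ∀ a b c : ℕ, IsABCTriple a b c → (a * b * c).primeFactors ⊆ S →
          (c : ℝ) < C * ((∏ p ∈ S, p : ℕ) : ℝ) ^ (1 + ε)) :=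
  (uniformSadicTowerFour_iff_boundedOmega_of_deepRegimeABC h₆).trans boundedOmega_iff_uniformSUnit

end Summit.ABC.ABC.Theorems.UniformSadicTowerFour.HeavyPlaces

end
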